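import Summits.AnomalousDissipation.AnomalousDissipation.Theorems.SolenoidalFractalHomogenisationRealisedQuasiStaticCellLawSectorExpDecay
import Summits.AnomalousDissipation.AnomalousDissipation.Theorems.SolenoidalFractalHomogenisationRealisedQuasiStaticCellLawGalerkinTransfer
import HarnessLib

/-!
# K2R `RealisedQuasiStaticCellLaw`, line `floquet-bloch`: exponential `L²` decay of EVERY weak solution of the cell problem
# in a low Bloch sector, from the uniform truncation bound (helper towards `stub_lowSectorDecay`;
# `--supports stmt-AnomalousDissipation-20446`)

Summits-side helper file (everything proved; no definitions, no named facts). `sectorEnergy_exp_decay` bounds the truncation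
energies uniformly in `N`; the initial truncation energy is at most `∫‖w₀‖²` (Bessel); `ae_integral_norm_sq_le_of_galerkinBound`
(Galerkin limit + uniqueness in the sector) transfers the bound to every weak solution:
`∫‖w(t)‖² ≤ θ₀⁻¹ · exp(-(log θ₀⁻¹ / P) t) · ∫‖w₀‖²` for a.e. `t ∈ (0, T)` (`sectorDecay_ae`), with the explicit per-period
factor `θ₀` of `sectorEnergy_exp_decay`. All hypotheses are independent of the truncation order (the index segment of the
principal coset is produced internally for every large `N`). This is STUB-PLAN `stub_lowSectorDecay` §3 assembled for ONE
sector and ONE good slot, pending only the numerical inputs (frame, `γ² > 0`, `θ > 0`, diagonal bounds) and the comparison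
of `log θ₀⁻¹ / P` with the crux rate.
-/

set_option linter.dupNamespace false

noncomputable section

namespace Summit.AnomalousDissipation.AnomalousDissipation.Theorems.SolenoidalFractalHomogenisation.RealisedQuasiStaticCellLaw

open Set MeasureTheory Filter Topology Function Matrix
open scoped InnerProductSpace ComplexConjugate Matrix
open Literature.Analysis Literature.Analysis.FunctionSpaces Literature.Analysis.FunctionSpaces.Torus
open Literature.Analysis.FluidPDE Literature.Analysis.FluidPDE.LatticeShear

variable {k₀ : ℕ}

/-- Every fixed frequency eventually lies in `freqBall N`. -/
theorem eventually_mem_freqBall (k : Fin 3 → ℤ) : ∀ᶠ N : ℕ in atTop, k ∈ freqBall N := by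
  obtain ⟨N₀, hN₀⟩ := exists_nat_ge (freqNormSq k)
  filter_upwards [eventually_ge_atTop N₀] with N hN
  rw [mem_freqBall]
  have h1 : (N₀ : ℝ) ≤ N := by exact_mod_cast hN
  have h2 : (N : ℝ) ≤ (N : ℝ) ^ 2 := by exact_mod_cast Nat.le_self_pow two_ne_zero N
  linarith

/-- **Exponential `L²` decay of every weak solution in a low sector** (one good slot `j`, positive coupling). -/
theorem sectorDecay_ae (W : LatticeWord k₀) {n : ℕ} (hn : 0 < n) {κ : ℝ} (hκ : 0 < κ)
    (ℓ : Fin 3 → ℤ) (hℓn : 2 * ‖latticeVec ℓ‖ ≤ n) {w₀ : UnitAddTorus (Fin 3) → EuclideanSpace ℝ (Fin 3)}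
    (hw₀ : FunctionSpaces.Torus.MemSobolev 1 (FunctionSpaces.EuclideanSpace.complexify ∘ w₀))
    (hdiv : FunctionSpaces.Torus.IsWeaklyDivFree w₀) (hmean : FunctionSpaces.Torus.HasZeroMean w₀)
    (hsupp : ∀ k : Fin 3 → ℤ, ¬ ((∃ z : Fin 3 → ℤ, k = ℓ + (n:ℤ) • z) ∨ (∃ z : Fin 3 → ℤ, k = -ℓ + (n:ℤ) • z)) →
      UnitAddTorus.mFourierCoeff (FunctionSpaces.EuclideanSpace.complexify ∘ w₀) k = 0)
    (j : Fin k₀) (hk : ∀ J : ℤ, ℓ + J • (fun i => (W.phase j).m i * (n : ℤ)) ≠ 0)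
    {ζr : Fin 3 → ℝ} (hζ1 : ζr ⬝ᵥ ζr = 1) (hζ0 : ζr ⬝ᵥ (fun i => ((ℓ i : ℤ) : ℝ)) = 0)
    (hζK : ζr ⬝ᵥ (fun i => (((fun i => (W.phase j).m i * (n : ℤ)) i : ℤ) : ℝ)) = 0)
    {p : ℤ → Fin 3 → ℝ}
    (hp : ∀ J : ℤ, p J = (Real.sqrt ((fun i => (((ℓ + J • (fun i => (W.phase j).m i * (n : ℤ))) i : ℤ) : ℝ)) ⬝ᵥ
        (fun i => (((ℓ + J • (fun i => (W.phase j).m i * (n : ℤ))) i : ℤ) : ℝ))))⁻¹ •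
        (fun i => (((ℓ + J • (fun i => (W.phase j).m i * (n : ℤ))) i : ℤ) : ℝ)) ⨯₃ ζr)
    (hs : ∀ J : ℤ, |p J ⬝ᵥ p (J + 1)| ≤ 1) (hγpos : 0 < (p 0 ⬝ᵥ p 1) ^ 2 + (p (-1) ⬝ᵥ p 0) ^ 2)
    (hd0 : freqNormSq ℓ / freqNormSq (fun i => (W.phase j).m i * (n : ℤ)) ≤ 1)
    (hd : ∀ J : ℤ, J ≠ 0 →
      1 / 2 ≤ freqNormSq (ℓ + J • (fun i => (W.phase j).m i * (n : ℤ))) / freqNormSq (fun i => (W.phase j).m i * (n : ℤ)))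
    (hd1 : freqNormSq (ℓ + (1 : ℤ) • (fun i => (W.phase j).m i * (n : ℤ))) /
      freqNormSq (fun i => (W.phase j).m i * (n : ℤ)) ≤ 2)
    (hdm1 : freqNormSq (ℓ + (-1 : ℤ) • (fun i => (W.phase j).m i * (n : ℤ))) /
      freqNormSq (fun i => (W.phase j).m i * (n : ℤ)) ≤ 2)
    (hθ : 0 < ∑ i, (W.phase j).e i * (ℓ i : ℝ))
    {T : ℝ} (hT : 0 < T) {w : ℝ → UnitAddTorus (Fin 3) → EuclideanSpace ℝ (Fin 3)}
    (hw : Torus.IsWeakPassiveVectorOn 0 T κ (W.cell n) w₀ w) :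
    ∀ᵐ t ∂(volume.restrict (Ioo 0 T)), ∫ x, ‖w t x‖ ^ 2 ≤
      (min 1 (max (2 * (5 / 3) * Real.exp (-(κ * (4 * Real.pi ^ 2 * freqNormSq (fun i => (W.phase j).m i * (n : ℤ))) *
            min 2 ((p 0 ⬝ᵥ p 1) ^ 2 + (p (-1) ⬝ᵥ p 0) ^ 2) *
            (2 * Real.pi * (∑ i, (W.phase j).e i * (ℓ i : ℝ)) *
              ‖Complex.exp ((W.phase j).φ * Complex.I) *
                (1 / (2 * ((2 * Real.pi * ‖latticeVec (W.phase j).m‖ : ℝ) : ℂ) * Complex.I))‖ * (1 / (n : ℝ)) /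
              (κ * (4 * Real.pi ^ 2 * freqNormSq (fun i => (W.phase j).m i * (n : ℤ)))) / 2) *
            min (2 * Real.pi * (∑ i, (W.phase j).e i * (ℓ i : ℝ)) *
              ‖Complex.exp ((W.phase j).φ * Complex.I) *
                (1 / (2 * ((2 * Real.pi * ‖latticeVec (W.phase j).m‖ : ℝ) : ℂ) * Complex.I))‖ * (1 / (n : ℝ)) /
              (κ * (4 * Real.pi ^ 2 * freqNormSq (fun i => (W.phase j).m i * (n : ℤ)))) / 2)
              (2 * Real.pi * (∑ i, (W.phase j).e i * (ℓ i : ℝ)) *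
              ‖Complex.exp ((W.phase j).φ * Complex.I) *
                (1 / (2 * ((2 * Real.pi * ‖latticeVec (W.phase j).m‖ : ℝ) : ℂ) * Complex.I))‖ * (1 / (n : ℝ)) /
              (κ * (4 * Real.pi ^ 2 * freqNormSq (fun i => (W.phase j).m i * (n : ℤ)))))⁻¹ / 80) *
              ((W.phase j).τ * (1 - W.ramp))))
          (Real.exp (-(8 * Real.pi ^ 2 * κ * ((n : ℝ) / 2) ^ 2) * ((W.phase j).τ * (1 - W.ramp))))))⁻¹ *
        Real.exp (-(Real.log (min 1 (max (2 * (5 / 3) * Real.exp (-(κ * (4 * Real.pi ^ 2 *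
            freqNormSq (fun i => (W.phase j).m i * (n : ℤ))) *
            min 2 ((p 0 ⬝ᵥ p 1) ^ 2 + (p (-1) ⬝ᵥ p 0) ^ 2) *
            (2 * Real.pi * (∑ i, (W.phase j).e i * (ℓ i : ℝ)) *
              ‖Complex.exp ((W.phase j).φ * Complex.I) *
                (1 / (2 * ((2 * Real.pi * ‖latticeVec (W.phase j).m‖ : ℝ) : ℂ) * Complex.I))‖ * (1 / (n : ℝ)) /
              (κ * (4 * Real.pi ^ 2 * freqNormSq (fun i => (W.phase j).m i * (n : ℤ)))) / 2) *
            min (2 * Real.pi * (∑ i, (W.phase j).e i * (ℓ i : ℝ)) *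
              ‖Complex.exp ((W.phase j).φ * Complex.I) *
                (1 / (2 * ((2 * Real.pi * ‖latticeVec (W.phase j).m‖ : ℝ) : ℂ) * Complex.I))‖ * (1 / (n : ℝ)) /
              (κ * (4 * Real.pi ^ 2 * freqNormSq (fun i => (W.phase j).m i * (n : ℤ)))) / 2)
              (2 * Real.pi * (∑ i, (W.phase j).e i * (ℓ i : ℝ)) *
              ‖Complex.exp ((W.phase j).φ * Complex.I) *
                (1 / (2 * ((2 * Real.pi * ‖latticeVec (W.phase j).m‖ : ℝ) : ℂ) * Complex.I))‖ * (1 / (n : ℝ)) /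
              (κ * (4 * Real.pi ^ 2 * freqNormSq (fun i => (W.phase j).m i * (n : ℤ)))))⁻¹ / 80) *
              ((W.phase j).τ * (1 - W.ramp))))
          (Real.exp (-(8 * Real.pi ^ 2 * κ * ((n : ℝ) / 2) ^ 2) * ((W.phase j).τ * (1 - W.ramp))))))⁻¹ /
          W.period) * t) *
        ∫ x, ‖w₀ x‖ ^ 2 := by
  classical
  set hPV := pvSetup_cell W hn hκ.le ℓ hw₀ hdiv hmean hsupp with hPVdef
  set K : Fin 3 → ℤ := fun i => (W.phase j).m i * (n : ℤ) with hK
  have hK0 : K ≠ 0 := cellFreq_ne_zero (W.phase j) hn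
  -- the abstract shape of the bound: `θ₀⁻¹ e^{-(log θ₀⁻¹/P) t}` with `0 < θ₀ ≤ 1`
  obtain ⟨θ₀, hθ₀⟩ : ∃ θ₀ : ℝ, θ₀ = min 1 (max (2 * (5 / 3) * Real.exp (-(κ * (4 * Real.pi ^ 2 * freqNormSq K) *
            min 2 ((p 0 ⬝ᵥ p 1) ^ 2 + (p (-1) ⬝ᵥ p 0) ^ 2) *
            (2 * Real.pi * (∑ i, (W.phase j).e i * (ℓ i : ℝ)) *
              ‖Complex.exp ((W.phase j).φ * Complex.I) *
                (1 / (2 * ((2 * Real.pi * ‖latticeVec (W.phase j).m‖ : ℝ) : ℂ) * Complex.I))‖ * (1 / (n : ℝ)) /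
              (κ * (4 * Real.pi ^ 2 * freqNormSq K)) / 2) *
            min (2 * Real.pi * (∑ i, (W.phase j).e i * (ℓ i : ℝ)) *
              ‖Complex.exp ((W.phase j).φ * Complex.I) *
                (1 / (2 * ((2 * Real.pi * ‖latticeVec (W.phase j).m‖ : ℝ) : ℂ) * Complex.I))‖ * (1 / (n : ℝ)) /
              (κ * (4 * Real.pi ^ 2 * freqNormSq K)) / 2)
              (2 * Real.pi * (∑ i, (W.phase j).e i * (ℓ i : ℝ)) *
              ‖Complex.exp ((W.phase j).φ * Complex.I) *
                (1 / (2 * ((2 * Real.pi * ‖latticeVec (W.phase j).m‖ : ℝ) : ℂ) * Complex.I))‖ * (1 / (n : ℝ)) /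
              (κ * (4 * Real.pi ^ 2 * freqNormSq K)))⁻¹ / 80) *
              ((W.phase j).τ * (1 - W.ramp))))
          (Real.exp (-(8 * Real.pi ^ 2 * κ * ((n : ℝ) / 2) ^ 2) * ((W.phase j).τ * (1 - W.ramp))))) := ⟨_, rfl⟩
  have hθ₀pos : 0 < θ₀ := by rw [hθ₀]; exact lt_min one_pos (lt_max_of_lt_right (Real.exp_pos _))
  have hE0 : 0 ≤ ∫ x, ‖w₀ x‖ ^ 2 := integral_nonneg fun x => by positivity
  -- eventually in `N`: the carrier and `ℓ, ℓ ± K` are resolved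
  have hev : ∀ᶠ N : ℕ in atTop, (Finset.univ.biUnion fun j : Fin k₀ =>
        ({(fun i => (W.phase j).m i * n), -(fun i => (W.phase j).m i * n)} : Finset (Fin 3 → ℤ))) ⊆ freqBall N ∧
      ℓ + (0 : ℤ) • K ∈ freqBall N ∧ ℓ + (1 : ℤ) • K ∈ freqBall N ∧ ℓ + (-1 : ℤ) • K ∈ freqBall N := by
    have h1 : ∀ᶠ N : ℕ in atTop, ∀ k ∈ (Finset.univ.biUnion fun j : Fin k₀ =>
        ({(fun i => (W.phase j).m i * n), -(fun i => (W.phase j).m i * n)} : Finset (Fin 3 → ℤ))), k ∈ freqBall N :=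
      (Filter.eventually_all_finset _).2 fun k _ => eventually_mem_freqBall k
    filter_upwards [h1, eventually_mem_freqBall (ℓ + (0 : ℤ) • K), eventually_mem_freqBall (ℓ + (1 : ℤ) • K),
      eventually_mem_freqBall (ℓ + (-1 : ℤ) • K)] with N hN h0 h1' hm1
    exact ⟨fun k hk' => hN k hk', h0, h1', hm1⟩
  -- the uniform bound on the truncations
  have hΦ : ∀ᶠ N in atTop, ∀ t, 0 ≤ t →
      ∑ k, ‖hPV.galerkinCoeff N t k‖ ^ 2 ≤ θ₀⁻¹ * Real.exp (-(Real.log θ₀⁻¹ / W.period) * t) * ∫ x, ‖w₀ x‖ ^ 2 := by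
    filter_upwards [hev] with N hN
    intro t ht
    obtain ⟨hBN, hℓ0, hℓ1, hℓm1⟩ := hN
    obtain ⟨Wset, hW⟩ := exists_cosetIndexSet hK0 ℓ N
    have hdec := sectorEnergy_exp_decay W hn hκ ℓ hℓn hw₀ hdiv hmean hsupp hBN j (fun J _ => hk J) hζ1 hζ0 hζK hp hW
      ((hW 0).2 hℓ0) ((hW 1).2 hℓ1) ((hW (-1)).2 hℓm1) (fun J _ => hs J) hγpos hd0 (fun J _ hJ0 => hd J hJ0) hd1 hdm1 hθ ht
    rw [← hθ₀] at hdec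
    -- identify the sums
    have hsum : ∀ τ, ∑ k ∈ freqBall N, ‖hPV.galerkinCoeffAt N τ k‖ ^ 2 = ∑ k, ‖hPV.galerkinCoeff N τ k‖ ^ 2 := by
      intro τ
      rw [← Finset.sum_coe_sort]
      exact Finset.sum_congr rfl fun k _ => by rw [Torus.PVSetup.galerkinCoeffAt, coeffExt_coe]
    rw [hsum t, hsum 0] at hdec
    have hinit : ∑ k, ‖hPV.galerkinCoeff N 0 k‖ ^ 2 ≤ ∫ x, ‖w₀ x‖ ^ 2 := hPV.sum_norm_sq_galerkinCoeff_le N le_rfl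
    have hfac : 0 ≤ θ₀⁻¹ * Real.exp (-(Real.log θ₀⁻¹ / W.period) * t) := by positivity
    exact hdec.trans (mul_le_mul_of_nonneg_left hinit hfac)
  have h := ae_integral_norm_sq_le_of_galerkinBound W hn hκ ℓ hw₀ hdiv hmean hsupp hΦ hT hw
  rw [hθ₀] at h
  exact h

end Summit.AnomalousDissipation.AnomalousDissipation.Theorems.SolenoidalFractalHomogenisation.RealisedQuasiStaticCellLaw

end
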